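import Literature.NumberTheory.Automorphic.MirabolicFourierStage
import HarnessLib

/-!
# Nested corners and columns: the invariances of the column coefficient for the next stage
(Cogdell, *Analytic theory of L-functions for GL_n* (2004), §1.1, proof of Thm. 1.1: "`φ_{e}` is
left invariant under `P_{n-1}(k)`, so the expansion can be iterated")

Topic `NumberTheory/Automorphic`; namespace `Literature.NumberTheory.Automorphic`. Book-keeping sequel
to `MirabolicFourierStage`. The stage identity `hasSum_norm_sq_colCoeff_mirabolic` at column size
`m` needs its input function to be left invariant under the rational corner `diag(GL_m(K), 1_{n-m})`
and under the column group `u_m(K^m)`; when the input is itself a column coefficient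
`Φ = colCoeff (m + 1 ≤ n) ν φ e` of the previous stage, `MirabolicFourierStage` provides invariance
under `diag(P_{m+1}(K), 1)` (`colCoeff_lastVec_glCorner_of_mem_mirabolic`). This file proves that the
two smaller groups sit inside that mirabolic through the nested block embeddings, as identities in
`GL_n(R)` over any commutative ring:

* `glCorner_apply_val`, `colUnipotent_apply_val` — the corner `diag(g, 1)` and the column unipotent
  `u(v)` entrywise in the natural-number coordinates of `Fin n` (no `finBlockEquiv` left);
* `glCorner_glCorner` — **transitivity of corners**: `diag(g, 1_{n-m}) = diag(diag(g, 1), 1_{n-m-1})`;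
  `colUnipotent_eq_glCorner_colUnipotent` — the column group of size `m` of `GL_n` is the corner image
  of the last-column group of `GL_{m+1}`;
* `glCorner_mem_mirabolic`, `colUnipotent_mem_mirabolic` — `diag(γ, 1)` and `(1 k; 0 1)` lie in the
  mirabolic `P_{m+1}(K)` (`Literature.LinearAlgebra.Matrix.mirabolic m K`);
* `ratGL_glCorner`, `ratGL_colUnipotent` — the adelic points of these rational elements;
* `colCoeff_invariant_glCorner`, `colCoeff_invariant_colUnipotent` (**the next-stage hypotheses**):
  for `φ` continuous, left invariant under `diag(GL_{m+1}(K), 1)` and under `u_{m+1}(K^{m+1})`, the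
  coefficient `Φ = colCoeff (m+1 ≤ n) ν φ e` is left invariant under `diag(GL_m(K), 1)` and under
  `u_m(K^m)`.

## References

* J. W. Cogdell, in Bernstein–Gelbart (eds.), *An Introduction to the Langlands Program* (2004),
  §1.1, proof of Thm. 1.1 [CogdellAnalyticTheory2004].
-/

noncomputable section

open scoped Matrix
open NumberField IsDedekindDomain MeasureTheory Function
open Literature.LinearAlgebra.Matrix

namespace Literature.NumberTheory.Automorphic

/-! ### Entrywise descriptions in `ℕ`-coordinates -/

section Ring

variable {R : Type*} [CommRing R] {n m : ℕ}

/-- Every index of `Fin n` is a left or right block index; the left case in `ℕ`-coordinates. [folklore] -/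
theorem finBlockEquiv_symm_of_lt (h : m ≤ n) (i : Fin n) (hi : (i : ℕ) < m) :
    (finBlockEquiv h).symm i = Sum.inl ⟨i, hi⟩ := by
  rw [Equiv.symm_apply_eq]
  exact Fin.ext (by rw [coe_finBlockEquiv_inl])

/-- The right case in `ℕ`-coordinates. [folklore] -/
theorem finBlockEquiv_symm_of_le (h : m ≤ n) (i : Fin n) (hi : m ≤ (i : ℕ)) :
    (finBlockEquiv h).symm i = Sum.inr ⟨i - m, by omega⟩ := by
  rw [Equiv.symm_apply_eq]
  exact Fin.ext (by rw [coe_finBlockEquiv_inr]; simp only; omega)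

/-- **The corner `diag(g, 1)` entrywise**: `g_{ij}` on the block `i, j < m`, the identity on the
block `i, j ≥ m`, zero elsewhere. [folklore] -/
theorem glCorner_apply_val (h : m ≤ n) (g : GL (Fin m) R) (i j : Fin n) :
    ((glCorner R h g : GL (Fin n) R) : Matrix (Fin n) (Fin n) R) i j =
      if hi : (i : ℕ) < m then (if hj : (j : ℕ) < m then (g : Matrix (Fin m) (Fin m) R) ⟨i, hi⟩ ⟨j, hj⟩ else 0)
      else (if (j : ℕ) < m then 0 else if i = j then 1 else 0) := by
  rw [coe_glCorner, Matrix.reindex_apply, Matrix.submatrix_apply]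
  by_cases hi : (i : ℕ) < m <;> by_cases hj : (j : ℕ) < m
  · rw [finBlockEquiv_symm_of_lt h i hi, finBlockEquiv_symm_of_lt h j hj, Matrix.fromBlocks_apply₁₁,
      dif_pos hi, dif_pos hj]
  · rw [finBlockEquiv_symm_of_lt h i hi, finBlockEquiv_symm_of_le h j (not_lt.1 hj),
      Matrix.fromBlocks_apply₁₂, dif_pos hi, dif_neg hj, Matrix.zero_apply]
  · rw [finBlockEquiv_symm_of_le h i (not_lt.1 hi), finBlockEquiv_symm_of_lt h j hj,
      Matrix.fromBlocks_apply₂₁, dif_neg hi, if_pos hj, Matrix.zero_apply]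
  · rw [finBlockEquiv_symm_of_le h i (not_lt.1 hi), finBlockEquiv_symm_of_le h j (not_lt.1 hj),
      Matrix.fromBlocks_apply₂₂, dif_neg hi, if_neg hj, Matrix.one_apply]
    by_cases hij : i = j
    · subst hij; simp
    · rw [if_neg hij, if_neg]
      intro h'
      apply hij
      have : (i : ℕ) - m = (j : ℕ) - m := by simpa using congrArg Fin.val h'
      exact Fin.ext (by omega)

/-- **The column unipotent `u(v)` entrywise**: `1` on the diagonal, `v_i` at `(i, m)` for `i < m`,
zero elsewhere. [folklore] -/
theorem colUnipotent_apply_val (h : m ≤ n) (v : Fin m → R) (i j : Fin n) :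
    ((colUnipotent n h (Multiplicative.ofAdd v) : GL (Fin n) R) : Matrix (Fin n) (Fin n) R) i j =
      (if i = j then 1 else 0) +
        if hi : (i : ℕ) < m then (if (j : ℕ) = m then v ⟨i, hi⟩ else 0) else 0 := by
  rw [coe_colUnipotent', Matrix.add_apply, Matrix.one_apply, Matrix.reindex_apply, Matrix.submatrix_apply]
  congr 1
  by_cases hi : (i : ℕ) < m <;> by_cases hj : (j : ℕ) < m
  · rw [finBlockEquiv_symm_of_lt h i hi, finBlockEquiv_symm_of_lt h j hj, Matrix.fromBlocks_apply₁₁,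
      dif_pos hi, Matrix.zero_apply, if_neg (by omega)]
  · rw [finBlockEquiv_symm_of_lt h i hi, finBlockEquiv_symm_of_le h j (not_lt.1 hj),
      Matrix.fromBlocks_apply₁₂, dif_pos hi, colVec_apply]
    simp only
    by_cases hjm : (j : ℕ) = m
    · rw [if_pos (by omega), if_pos hjm]
    · rw [if_neg (by omega), if_neg hjm]
  · rw [finBlockEquiv_symm_of_le h i (not_lt.1 hi), finBlockEquiv_symm_of_lt h j hj,
      Matrix.fromBlocks_apply₂₁, dif_neg hi, Matrix.zero_apply]
  · rw [finBlockEquiv_symm_of_le h i (not_lt.1 hi), finBlockEquiv_symm_of_le h j (not_lt.1 hj),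
      Matrix.fromBlocks_apply₂₂, dif_neg hi, Matrix.zero_apply]

/-- **Transitivity of corner embeddings**: `diag(g, 1_{n-m}) = diag(diag(g, 1_1), 1_{n-m-1})` in
`GL_n(R)` for `m + 1 ≤ n`. [folklore] -/
theorem glCorner_glCorner (h : m ≤ n) (h' : m + 1 ≤ n) (g : GL (Fin m) R) :
    glCorner R h' (glCorner R (Nat.le_succ m) g) = glCorner R h g := by
  refine Units.ext (Matrix.ext fun i j => ?_)
  rw [glCorner_apply_val, glCorner_apply_val]
  by_cases hi : (i : ℕ) < m + 1 <;> by_cases hj : (j : ℕ) < m + 1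
  · rw [dif_pos hi, dif_pos hj, glCorner_apply_val]
    simp only
    by_cases hi' : (i : ℕ) < m <;> by_cases hj' : (j : ℕ) < m
    · rw [dif_pos hi', dif_pos hj', dif_pos hi', dif_pos hj']
    · rw [dif_pos hi', dif_neg hj', dif_pos hi', dif_neg hj']
    · rw [dif_neg hi', if_pos hj', dif_neg hi', if_pos hj']
    · rw [dif_neg hi', if_neg hj', dif_neg hi', if_neg hj']
      have hii : (i : ℕ) = m := by omega
      have hjj : (j : ℕ) = m := by omega
      have : i = j := Fin.ext (by omega)
      rw [if_pos this, if_pos (Fin.ext (by simp [hii, hjj]))]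
  · rw [dif_pos hi, dif_neg hj]
    by_cases hi' : (i : ℕ) < m
    · rw [dif_pos hi', dif_neg (show ¬ ((j : ℕ) < m) by omega)]
    · rw [dif_neg hi', if_neg (by omega), if_neg]
      intro hij; apply hj; rw [← hij]; exact hi
  · rw [dif_neg hi, if_pos hj, dif_neg (show ¬ ((i : ℕ) < m) by omega)]
    by_cases hj' : (j : ℕ) < m
    · rw [if_pos hj']
    · rw [if_neg hj', if_neg]
      intro hij; apply hi; rw [hij]; exact hj
  · rw [dif_neg hi, if_neg hj, dif_neg (show ¬ ((i : ℕ) < m) by omega),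
      if_neg (show ¬ ((j : ℕ) < m) by omega)]

/-- **The column group of size `m` is the corner image of the last-column group of `GL_{m+1}`**:
`u_m(v) = diag(u^{(m+1)}_m(v), 1_{n-m-1})` in `GL_n(R)`. [folklore] -/
theorem colUnipotent_eq_glCorner_colUnipotent (h : m ≤ n) (h' : m + 1 ≤ n) (v : Fin m → R) :
    colUnipotent n h (Multiplicative.ofAdd v) =
      glCorner R h' (colUnipotent (m + 1) (Nat.le_succ m) (Multiplicative.ofAdd v)) := by
  refine Units.ext (Matrix.ext fun i j => ?_)
  rw [colUnipotent_apply_val, glCorner_apply_val]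
  by_cases hi : (i : ℕ) < m + 1 <;> by_cases hj : (j : ℕ) < m + 1
  · rw [dif_pos hi, dif_pos hj, colUnipotent_apply_val]
    simp only [Fin.ext_iff]
  · rw [dif_pos hi, dif_neg hj, if_neg (by intro hij; apply hj; rw [← hij]; exact hi)]
    by_cases hi' : (i : ℕ) < m
    · rw [dif_pos hi', if_neg (show ¬ ((j : ℕ) = m) by omega), zero_add]
    · rw [dif_neg hi', add_zero]
  · rw [dif_neg hi, if_pos hj, if_neg (by intro hij; apply hi; rw [hij]; exact hj),
      dif_neg (show ¬ ((i : ℕ) < m) by omega), add_zero]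
  · rw [dif_neg hi, if_neg hj, dif_neg (show ¬ ((i : ℕ) < m) by omega), add_zero]

end Ring

/-! ### Membership in the mirabolic, adelic points -/

section Field

variable {K : Type*} [Field K] {m : ℕ}

/-- `diag(γ, 1) ∈ P_{m+1}(K)`: its last row is `(0, …, 0, 1)`. [folklore] -/
theorem glCorner_mem_mirabolic (γ : GL (Fin m) K) : glCorner K (Nat.le_succ m) γ ∈ mirabolic m K := by
  rw [mem_mirabolic_iff_row]
  intro j
  rw [glCorner_apply_val]
  have hlast : ¬ ((Fin.last m : Fin (m + 1)) : ℕ) < m := by simp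
  rw [dif_neg hlast]
  by_cases hj : (j : ℕ) < m
  · rw [if_pos hj, if_neg]
    intro h; rw [h] at hj; simp at hj
  · rw [if_neg hj]
    have : j = Fin.last m := Fin.ext (by have := j.isLt; simp; omega)
    rw [if_pos this.symm, if_pos this]

/-- `(1 k; 0 1) ∈ P_{m+1}(K)`: the last row of a last-column unipotent is `(0, …, 0, 1)`. [folklore] -/
theorem colUnipotent_mem_mirabolic (k : Fin m → K) :
    colUnipotent (m + 1) (Nat.le_succ m) (Multiplicative.ofAdd k) ∈ mirabolic m K := by
  rw [mem_mirabolic_iff_row]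
  intro j
  rw [colUnipotent_apply_val]
  have hlast : ¬ ((Fin.last m : Fin (m + 1)) : ℕ) < m := by simp
  rw [dif_neg hlast, add_zero]
  by_cases hj : Fin.last m = j
  · rw [if_pos hj, if_pos hj.symm]
  · rw [if_neg hj, if_neg (Ne.symm hj)]

variable (K : Type) [Field K] [NumberField K] {n : ℕ}

/-- The adelic points of a rational corner are the corner of the adelic points:
`(diag(γ, 1))_𝔸 = diag(γ_𝔸, 1)`. [folklore] -/
theorem ratGL_glCorner {m : ℕ} (h : m ≤ n) (γ : GL (Fin m) K) :
    ratGL K (glCorner K h γ) = glCorner (AdeleRing (𝓞 K) K) h (ratGL K γ) := by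
  refine Units.ext (Matrix.ext fun i j => ?_)
  rw [ratGL_apply, glCorner_apply_val, glCorner_apply_val]
  by_cases hi : (i : ℕ) < m <;> by_cases hj : (j : ℕ) < m
  · rw [dif_pos hi, dif_pos hj, dif_pos hi, dif_pos hj, ratGL_apply]
  · rw [dif_pos hi, dif_neg hj, dif_pos hi, dif_neg hj, map_zero]
  · rw [dif_neg hi, if_pos hj, dif_neg hi, if_pos hj, map_zero]
  · rw [dif_neg hi, if_neg hj, dif_neg hi, if_neg hj]
    split_ifs <;> simp

/-- The adelic points of a rational column unipotent: `(u(k))_𝔸 = u(k_𝔸)`. [folklore] -/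
theorem ratGL_colUnipotent {m : ℕ} (h : m ≤ n) (k : Fin m → K) :
    ratGL K (colUnipotent n h (Multiplicative.ofAdd k)) =
      colUnipotent n h (Multiplicative.ofAdd fun i => algebraMap K (AdeleRing (𝓞 K) K) (k i)) := by
  refine Units.ext (Matrix.ext fun i j => ?_)
  rw [ratGL_apply, colUnipotent_apply_val, colUnipotent_apply_val, map_add]
  congr 1
  · split_ifs <;> simp
  · by_cases hi : (i : ℕ) < m
    · rw [dif_pos hi, dif_pos hi]
      split_ifs <;> simp
    · rw [dif_neg hi, dif_neg hi, map_zero]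

end Field

/-! ### The next-stage invariances of the column coefficient -/

section NextStage

variable (K : Type) [Field K] [NumberField K] {n m : ℕ}
  [MeasurableSpace (AdeleRing (𝓞 K) K)] [BorelSpace (AdeleRing (𝓞 K) K)]

variable {K} in
/-- **Invariance of `Φ = φ_e` under the smaller rational corner.** If `φ` is continuous, left
invariant under `diag(GL_{m+1}(K), 1)` and under `u_{m+1}(K^{m+1})`, then
`Φ = colCoeff (m+1 ≤ n) ν φ e` is left invariant under `diag(GL_m(K), 1)`
(`diag(γ, 1_{n-m}) = diag(diag(γ,1), 1)` with `diag(γ, 1) ∈ P_{m+1}(K)`, and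
`colCoeff_lastVec_glCorner_of_mem_mirabolic`). This is hypothesis `hinv` of the stage identity at
column size `m`. [cite: CogdellAnalyticTheory2004, §1.1] -/
theorem colCoeff_invariant_glCorner (h : m ≤ n) (h' : m + 1 ≤ n)
    (ν : Measure (Fin (m + 1) → AdeleRing (𝓞 K) K)) [ν.IsAddHaarMeasure]
    {φ : GL (Fin n) (AdeleRing (𝓞 K) K) → ℂ} (hφc : Continuous φ)
    (hinv : ∀ (γ : GL (Fin (m + 1)) K) (x : GL (Fin n) (AdeleRing (𝓞 K) K)),
      φ (glCorner (AdeleRing (𝓞 K) K) h' (ratGL K γ) * x) = φ x)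
    (hper : ∀ (k : Fin (m + 1) → K) (x : GL (Fin n) (AdeleRing (𝓞 K) K)),
      φ (colUnipotent n h' (Multiplicative.ofAdd fun i => algebraMap K (AdeleRing (𝓞 K) K) (k i)) * x) =
        φ x)
    (γ : GL (Fin m) K) (x : GL (Fin n) (AdeleRing (𝓞 K) K)) :
    colCoeff h' ν φ (lastVec m K) (glCorner (AdeleRing (𝓞 K) K) h (ratGL K γ) * x) =
      colCoeff h' ν φ (lastVec m K) x := by
  have e : glCorner (AdeleRing (𝓞 K) K) h (ratGL K γ) =
      glCorner (AdeleRing (𝓞 K) K) h' (ratGL K (glCorner K (Nat.le_succ m) γ)) := by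
    rw [ratGL_glCorner, glCorner_glCorner]
  rw [e]
  exact colCoeff_lastVec_glCorner_of_mem_mirabolic h' ν hφc (glCorner_mem_mirabolic γ) (hinv _) hper x

variable {K} in
/-- **Periodicity of `Φ = φ_e` under the smaller rational column group.** Under the same hypotheses,
`Φ = colCoeff (m+1 ≤ n) ν φ e` is left invariant under `u_m(K^m)` (`u_m(k) = diag((1 k; 0 1), 1)` with
`(1 k; 0 1) ∈ P_{m+1}(K)`). This is hypothesis `hper` of the stage identity at column size `m`.
[cite: CogdellAnalyticTheory2004, §1.1] -/
theorem colCoeff_invariant_colUnipotent (h : m ≤ n) (h' : m + 1 ≤ n)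
    (ν : Measure (Fin (m + 1) → AdeleRing (𝓞 K) K)) [ν.IsAddHaarMeasure]
    {φ : GL (Fin n) (AdeleRing (𝓞 K) K) → ℂ} (hφc : Continuous φ)
    (hinv : ∀ (γ : GL (Fin (m + 1)) K) (x : GL (Fin n) (AdeleRing (𝓞 K) K)),
      φ (glCorner (AdeleRing (𝓞 K) K) h' (ratGL K γ) * x) = φ x)
    (hper : ∀ (k : Fin (m + 1) → K) (x : GL (Fin n) (AdeleRing (𝓞 K) K)),
      φ (colUnipotent n h' (Multiplicative.ofAdd fun i => algebraMap K (AdeleRing (𝓞 K) K) (k i)) * x) =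
        φ x)
    (k : Fin m → K) (x : GL (Fin n) (AdeleRing (𝓞 K) K)) :
    colCoeff h' ν φ (lastVec m K)
        (colUnipotent n h (Multiplicative.ofAdd fun i => algebraMap K (AdeleRing (𝓞 K) K) (k i)) * x) =
      colCoeff h' ν φ (lastVec m K) x := by
  have e : colUnipotent n h (Multiplicative.ofAdd fun i => algebraMap K (AdeleRing (𝓞 K) K) (k i)) =
      glCorner (AdeleRing (𝓞 K) K) h' (ratGL K (colUnipotent (m + 1) (Nat.le_succ m) (Multiplicative.ofAdd k))) := by
    rw [← ratGL_colUnipotent, colUnipotent_eq_glCorner_colUnipotent h h', ratGL_glCorner]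
  rw [e]
  exact colCoeff_lastVec_glCorner_of_mem_mirabolic h' ν hφc (colUnipotent_mem_mirabolic k) (hinv _) hper x

end NextStage

end Literature.NumberTheory.Automorphic
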